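import Summits.AnomalousDissipation.AnomalousDissipation.Theses.LambCircleTG
import Summits.AnomalousDissipation.AnomalousDissipation.Theorems.BaireTransferRobustLoudUpgradeStubSteadyWindow
import Literature.Analysis.FluidPDE.TorusClassicalLerayHopfProofs

/-!
# Route LambCircleTG — the shared support `SteadyToSummit`

The support item stmt-AnomalousDissipation-1311 is wanted by two routes with verbatim-identical
declarations, `…Theses.SteadyWeakLimit.SteadyToSummit` (proved as `steadyToSummit_proof` in
`Summits/AnomalousDissipation/AnomalousDissipation/Theorems/SteadyWeakLimitSteadyToSummit.lean`) and
`…Theses.LambCircleTG.SteadyToSummit`: the steady zeroth law (CoherentStates' crux 0219 verbatim)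
implies `AnomalousDissipation = Literature.Turb.ZerothLaw`. This file proves the LambCircleTG copy
under its own name, by the same ten lines, so that route's assembly can cite it.

A steady classical state `u j` of `NS_{ν j}(f)` is the time-independent classical solution
`fun _ => u j` on `ℝ × T³`, hence a global Leray–Hopf solution from its value at time `0`
(`Literature.Analysis.FunctionSpaces.Torus.IsClassicalNSSolutionOn.isGlobalLerayHopf`;
Robinson–Rodrigo–Sadowski 2016 Thm 6.5, Galdi 2000 Thm 4.1), and its long-time budgets are the
instantaneous ones (Cesàro means of constants, Doering–Foias 2002 §2; spectral = pointwise gradient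
norm on smooth slices, Grafakos 2014 Prop. 3.2.6) — the landed lemmas
`SteadyWindow.meanEnergy_const` / `SteadyWindow.meanDissipation_const` of
`Theorems/BaireTransferRobustLoudUpgradeStubSteadyWindow.lean`, reused rather than restated.

Design: self-contained (does not import the SteadyWeakLimit twin), no new definitions or lemmas.
-/

namespace Summit.AnomalousDissipation.AnomalousDissipation.Theorems

-- the mandated namespace `Summit.<Summit>.<Problem>.Theorems` repeats `AnomalousDissipation` (single-problem summit)
set_option linter.dupNamespace false

open Literature.Analysis.FunctionSpaces Literature.Analysis.FunctionSpaces.Torus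
open Literature.Analysis.FluidPDE
open Summit.AnomalousDissipation.AnomalousDissipation.Theorems.RobustLoudUpgrade

/-- **The steady zeroth law implies the summit**, the LambCircleTG route's copy of the shared
support item stmt-AnomalousDissipation-1311: a smooth divergence-free mean-zero steady force `f`,
viscosities `ν j → 0⁺` and steady classical Navier–Stokes states `(u j, p j)` forced by `f` with
`∫ ‖u j‖² ≤ E` and `ε ≤ ν j * gradNormSq (u j)` (`ε > 0`) give `AnomalousDissipation`: the fields
`fun _ => u j` are global Leray–Hopf solutions from `u j` (`IsClassicalNSSolutionOn.isGlobalLerayHopf`)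
with mean energy `∫ ‖u j‖² ≤ E` (`SteadyWindow.meanEnergy_const`) and mean dissipation
`ν j * gradNormSq (u j) ≥ ε` (`SteadyWindow.meanDissipation_const`, slice smoothness from the
classical solution). Same proof as `steadyToSummit_proof` (route SteadyWeakLimit). [folklore] -/
theorem lambCircleTG_steadyToSummit_proof :
    Summit.AnomalousDissipation.AnomalousDissipation.Theses.LambCircleTG.SteadyToSummit := by
  unfold Summit.AnomalousDissipation.AnomalousDissipation.Theses.LambCircleTG.SteadyToSummit
  rintro ⟨f, hf, hdiv, hmean, ν, u, p, hν, hν0, hsol, ⟨E, hE⟩, ε, hε, hεle⟩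
  refine ⟨f, hf, hdiv, hmean, ν, fun j => u j, fun j _ => u j, hν, hν0,
    fun j => (hsol j).isGlobalLerayHopf, ⟨E, fun j => ?_⟩, ε, hε, fun j => ?_⟩
  · rw [SteadyWindow.meanEnergy_const]
    exact hE j
  · rw [SteadyWindow.meanDissipation_const (ν j)
      ((hsol j).smooth_velocity.isSmooth_slice (Set.mem_univ (0 : ℝ)))]
    exact hεle j

end Summit.AnomalousDissipation.AnomalousDissipation.Theorems
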